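import Mathlib
import HarnessLib

/-!
# Brascamp–Lieb 1976, Theorem 5.1 (n = 1) — auxiliary Gaussian half-line calculus

`Literature/Probability/Distributions/`. Helper lemmas for the one-dimensional moment inequality
of Brascamp–Lieb (J. Funct. Anal. 22 (1976), Thm 5.1 / Lemma 5.3; files
`BrascampLiebMomentCore`, `BrascampLiebMomentInequality`): the Gaussian weight `e^{-b x²}` (`b > 0`), its half-line moments
`M_p(b) = ∫_{(0,∞)} x^p e^{-b x²} dx = b^{-(p+1)/2} Γ((p+1)/2)/2` (Gradshteyn–Ryzhik 3.326.2), the tail identity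
`2b ∫_{(s,∞)} x e^{-b x²} dx = e^{-b s²}`, Chebyshev's rearrangement inequality on `(0, ∞)` in
one-sign-change form (the printed (5.3)–(5.4)), and the auxiliary function
`ψ_p(y) = e^{b y²} ∫_y^∞ (t^p − c_p) e^{-b t²} dt`, `c_p = M_p/M_0`, with `ψ_p(0) = 0`,
`ψ_p' = λ_p ≥ 0` on `[0, ∞)` for `p ≥ 1` (the printed monotonicity step (5.10)–(5.11), here in the
derivative-free form `λ_p(y) e^{-b y²} = 2b ∫_y^∞ [y (t^p − c_p) − t (y^p − c_p)] e^{-bt²} dt`) and the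
growth bound `0 ≤ ψ_p(y) ≤ 2^p (M_p + M_0 y^p)`. No named facts.

References: H. J. Brascamp, E. H. Lieb, J. Funct. Anal. 22 (1976) 366–389, §5 [BrascampLieb1976];
I. S. Gradshteyn, I. M. Ryzhik, Table of Integrals, Series, and Products, 8th ed. (2015), 3.321.3, 3.326.2
[GradshteynRyzhik2015].
-/

noncomputable section

open MeasureTheory Set Filter Real
open scoped Topology

namespace Literature.Probability.Distributions

/-! ### The Gaussian weight and its half-line moments -/

/-- Half-line Gaussian moment `M_p(b) = ∫_{(0,∞)} x^p e^{-b x²} dx` (the Gaussian averages `⟨·⟩₁`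
of the source, folded onto `(0, ∞)`). [cite: GradshteynRyzhik2015, 3.326.2] -/
def gaussHalfMoment (b : ℝ) (p : ℕ) : ℝ := ∫ x in Ioi (0 : ℝ), x ^ p * Real.exp (-b * x ^ 2)

/-- `x^p e^{-bx²}` is integrable. [folklore] -/
private theorem integrable_pow_mul_gauss {b : ℝ} (hb : 0 < b) (p : ℕ) :
    Integrable fun x : ℝ => x ^ p * Real.exp (-b * x ^ 2) := by
  simpa [Real.rpow_natCast] using integrable_rpow_mul_exp_neg_mul_sq hb (s := (p : ℝ))
    (by have : (0 : ℝ) ≤ p := Nat.cast_nonneg p; linarith)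

/-- `M_p(b) = b^{-(p+1)/2} Γ((p+1)/2) / 2`. [cite: GradshteynRyzhik2015, 3.326.2] -/
theorem gaussHalfMoment_eq {b : ℝ} (hb : 0 < b) (p : ℕ) :
    gaussHalfMoment b p =
      b ^ (-(((p : ℝ) + 1) / 2)) * (1 / 2) * Real.Gamma (((p : ℝ) + 1) / 2) := by
  have h := integral_rpow_mul_exp_neg_mul_rpow (p := 2) (q := (p : ℝ)) (b := b) two_pos
    (by have : (0 : ℝ) ≤ p := Nat.cast_nonneg p; linarith) hb
  have h' : (∫ x in Ioi (0:ℝ), x ^ p * Real.exp (-b * x ^ 2)) =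
      ∫ x in Ioi (0:ℝ), x ^ (p : ℝ) * Real.exp (-b * x ^ (2 : ℝ)) :=
    setIntegral_congr_fun measurableSet_Ioi (fun x _ => by
      simp only [Real.rpow_natCast, Real.rpow_two])
  rw [gaussHalfMoment, h', h]; ring_nf

/-- `M_p(b) > 0`. [cite: GradshteynRyzhik2015, 3.326.2] -/
theorem gaussHalfMoment_pos {b : ℝ} (hb : 0 < b) (p : ℕ) : 0 < gaussHalfMoment b p := by
  rw [gaussHalfMoment_eq hb]
  have h1 : 0 < Real.Gamma (((p : ℝ) + 1) / 2) := Real.Gamma_pos_of_pos (by positivity)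
  have h2 : 0 < b ^ (-(((p : ℝ) + 1) / 2)) := Real.rpow_pos_of_pos hb _
  positivity

/-- `∫_ℝ |x|^p e^{-bx²} dx = 2 M_p(b)` (the numerator of `⟨|x|^p⟩₁`).
[cite: GradshteynRyzhik2015, 3.326.2] -/
theorem integral_abs_pow_mul_gauss (b : ℝ) (p : ℕ) :
    ∫ x : ℝ, |x| ^ p * Real.exp (-b * x ^ 2) = 2 * gaussHalfMoment b p := by
  have h := integral_comp_abs (f := fun t : ℝ => t ^ p * Real.exp (-b * t ^ 2))
  simpa [sq_abs, gaussHalfMoment] using h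

/-- `∫_ℝ e^{-bx²} dx = 2 M_0(b)` (the denominator of `⟨·⟩₁`). [cite: GradshteynRyzhik2015, 3.321.3] -/
theorem integral_gauss_eq_two_mul (b : ℝ) :
    ∫ x : ℝ, Real.exp (-b * x ^ 2) = 2 * gaussHalfMoment b 0 := by
  simpa using integral_abs_pow_mul_gauss b 0

/-- The tail identity `∫_{(s,∞)} x e^{-bx²} dx = e^{-bs²}/(2b)`, i.e. `(e^{-bx²})' = -2bx e^{-bx²}`
integrated — the identity behind the printed (5.6). [cite: BrascampLieb1976, Lemma 5.3 eq. (5.6)] -/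
theorem setIntegral_Ioi_id_mul_gauss {b : ℝ} (hb : 0 < b) (s : ℝ) :
    ∫ x in Ioi s, x * Real.exp (-b * x ^ 2) = Real.exp (-b * s ^ 2) / (2 * b) := by
  have hb0 : b ≠ 0 := hb.ne'
  have hderiv : ∀ x ∈ Ioi s, HasDerivAt (fun x => -Real.exp (-b * x ^ 2) / (2 * b))
      (x * Real.exp (-b * x ^ 2)) x := by
    intro x _
    have h1 : HasDerivAt (fun x => -b * x ^ 2) (-b * (2 * x)) x := by
      simpa using ((hasDerivAt_pow 2 x).const_mul (-b))
    have h2 : HasDerivAt (fun x => -Real.exp (-b * x ^ 2) / (2 * b))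
        (-(Real.exp (-b * x ^ 2) * (-b * (2 * x))) / (2 * b)) x :=
      ((h1.exp).neg).div_const (2 * b)
    refine h2.congr_deriv ?_
    rw [div_eq_iff (by positivity)]
    ring
  have hcont : ContinuousWithinAt (fun x => -Real.exp (-b * x ^ 2) / (2 * b)) (Ici s) s :=
    (by fun_prop : Continuous fun x => -Real.exp (-b * x ^ 2) / (2 * b)).continuousWithinAt
  have hint : IntegrableOn (fun x => x * Real.exp (-b * x ^ 2)) (Ioi s) :=
    (integrable_mul_exp_neg_mul_sq hb).integrableOn
  have hlim : Tendsto (fun x => -Real.exp (-b * x ^ 2) / (2 * b)) atTop (𝓝 (-0 / (2 * b))) := by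
    refine (Tendsto.neg ?_).div_const _
    have : Tendsto (fun x : ℝ => -b * x ^ 2) atTop atBot := by
      have h := (tendsto_pow_atTop (α := ℝ) two_ne_zero).const_mul_atTop hb
      simp only [neg_mul]
      exact tendsto_neg_atTop_atBot.comp h
    exact Real.tendsto_exp_atBot.comp this
  rw [integral_Ioi_of_hasDerivAt_of_tendsto hcont hderiv hint hlim]
  ring

/-- `2b ∫_{(s,∞)} x e^{-bx²} dx = e^{-bs²}`. [cite: BrascampLieb1976, Lemma 5.3 eq. (5.6)] -/
theorem two_mul_setIntegral_Ioi_id_mul_gauss {b : ℝ} (hb : 0 < b) (s : ℝ) :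
    2 * b * ∫ x in Ioi s, x * Real.exp (-b * x ^ 2) = Real.exp (-b * s ^ 2) := by
  rw [setIntegral_Ioi_id_mul_gauss hb]; field_simp

/-- Translation of a half-line integral: `∫_{(y,∞)} f = ∫_{(0,∞)} f(· + y)`. [folklore] -/
private theorem setIntegral_Ioi_eq_comp_add (f : ℝ → ℝ) (y : ℝ) :
    ∫ t in Ioi y, f t = ∫ u in Ioi (0 : ℝ), f (u + y) := by
  rw [← integral_indicator measurableSet_Ioi, ← integral_indicator measurableSet_Ioi,
    ← integral_add_right_eq_self (fun t => (Ioi y).indicator f t) y]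
  congr 1 with u
  by_cases hu : u ∈ Ioi (0 : ℝ)
  · have : u + y ∈ Ioi y := by simp [mem_Ioi] at hu ⊢; linarith
    simp [indicator_of_mem hu, indicator_of_mem this]
  · have : u + y ∉ Ioi y := by simp [mem_Ioi] at hu ⊢; linarith
    simp [indicator_of_notMem hu, indicator_of_notMem this]

/-! ### Chebyshev's rearrangement inequality on `(0, ∞)` (BL (5.3)–(5.4)) -/

/-- For `f` non-increasing on `[0, ∞)` and `p ≥ 1`:
`M_0 · ∫_{(0,∞)} x^p e^{-bx²} f ≤ M_p · ∫_{(0,∞)} e^{-bx²} f` — the covariance of an increasing and a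
decreasing function under the half-Gaussian is `≤ 0`. Proved in one-sign-change form: with
`y₀^p = c = M_p/M_0`, `(x^p − c)(f x − f y₀) ≤ 0` pointwise. [cite: BrascampLieb1976, (5.3)–(5.4)] -/
theorem gaussHalf_chebyshev {b : ℝ} (hb : 0 < b) {p : ℕ} (hp : p ≠ 0) {f : ℝ → ℝ}
    (hf : ∀ ⦃x y : ℝ⦄, 0 ≤ x → x ≤ y → f y ≤ f x)
    (h0 : IntegrableOn (fun x => Real.exp (-b * x ^ 2) * f x) (Ioi 0))
    (hP : IntegrableOn (fun x => x ^ p * (Real.exp (-b * x ^ 2) * f x)) (Ioi 0)) :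
    gaussHalfMoment b 0 * ∫ x in Ioi (0:ℝ), x ^ p * (Real.exp (-b * x ^ 2) * f x) ≤
      gaussHalfMoment b p * ∫ x in Ioi (0:ℝ), Real.exp (-b * x ^ 2) * f x := by
  set M0 := gaussHalfMoment b 0 with hM0
  set Mp := gaussHalfMoment b p with hMp
  have hM0pos : 0 < M0 := gaussHalfMoment_pos hb 0
  have hMppos : 0 < Mp := gaussHalfMoment_pos hb p
  set c := Mp / M0 with hc
  have hcnn : 0 ≤ c := (div_pos hMppos hM0pos).le
  set y₀ := c ^ ((p : ℝ)⁻¹) with hy₀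
  have hy₀nn : 0 ≤ y₀ := Real.rpow_nonneg hcnn _
  have hy₀p : y₀ ^ p = c := Real.rpow_inv_natCast_pow hcnn hp
  -- pointwise one-sign-change inequality
  have hpt : ∀ x ∈ Ioi (0:ℝ), (x ^ p - c) * (Real.exp (-b * x ^ 2) * f x) ≤
      f y₀ * ((x ^ p - c) * Real.exp (-b * x ^ 2)) := by
    intro x hx
    have hx0 : 0 ≤ x := le_of_lt hx
    have hw : 0 < Real.exp (-b * x ^ 2) := Real.exp_pos _
    have key : (x ^ p - c) * (f x - f y₀) ≤ 0 := by
      rcases le_total x y₀ with hxy | hxy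
      · have h1 : x ^ p ≤ c := hy₀p ▸ pow_le_pow_left₀ hx0 hxy p
        have h2 : f y₀ ≤ f x := hf hx0 hxy
        nlinarith
      · have h1 : c ≤ x ^ p := hy₀p ▸ pow_le_pow_left₀ hy₀nn hxy p
        have h2 : f x ≤ f y₀ := hf hy₀nn hxy
        nlinarith
    nlinarith
  have hI1 : IntegrableOn (fun x => (x ^ p - c) * (Real.exp (-b * x ^ 2) * f x)) (Ioi 0) := by
    have : (fun x => (x ^ p - c) * (Real.exp (-b * x ^ 2) * f x)) =
        fun x => x ^ p * (Real.exp (-b * x ^ 2) * f x) - c * (Real.exp (-b * x ^ 2) * f x) := by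
      funext x; ring
    rw [this]; exact hP.sub (h0.const_mul c)
  have hI2 : IntegrableOn (fun x => f y₀ * ((x ^ p - c) * Real.exp (-b * x ^ 2))) (Ioi 0) := by
    refine Integrable.const_mul ?_ _
    have : (fun x => (x ^ p - c) * Real.exp (-b * x ^ 2)) =
        fun x => x ^ p * Real.exp (-b * x ^ 2) - c * Real.exp (-b * x ^ 2) := by funext x; ring
    rw [this]
    exact ((integrable_pow_mul_gauss hb p).sub
      ((integrable_exp_neg_mul_sq hb).const_mul c)).integrableOn
  have hle := setIntegral_mono_on hI1 hI2 measurableSet_Ioi hpt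
  -- evaluate the right-hand side: `∫ (x^p - c) e^{-bx²} = Mp - c M0 = 0`
  have hR : ∫ x in Ioi (0:ℝ), f y₀ * ((x ^ p - c) * Real.exp (-b * x ^ 2)) = 0 := by
    rw [integral_const_mul]
    have : ∫ x in Ioi (0:ℝ), (x ^ p - c) * Real.exp (-b * x ^ 2) = Mp - c * M0 := by
      have e1 : (fun x : ℝ => (x ^ p - c) * Real.exp (-b * x ^ 2)) =
          fun x => x ^ p * Real.exp (-b * x ^ 2) - c * Real.exp (-b * x ^ 2) := by funext x; ring
      rw [e1, integral_sub (integrable_pow_mul_gauss hb p).integrableOn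
        ((integrable_exp_neg_mul_sq hb).const_mul c).integrableOn, integral_const_mul]
      simp [hMp, hM0, gaussHalfMoment]
    rw [this, hc, div_mul_cancel₀ _ hM0pos.ne']; ring
  -- evaluate the left-hand side
  have hL : ∫ x in Ioi (0:ℝ), (x ^ p - c) * (Real.exp (-b * x ^ 2) * f x) =
      (∫ x in Ioi (0:ℝ), x ^ p * (Real.exp (-b * x ^ 2) * f x)) -
        c * ∫ x in Ioi (0:ℝ), Real.exp (-b * x ^ 2) * f x := by
    have e1 : (fun x => (x ^ p - c) * (Real.exp (-b * x ^ 2) * f x)) =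
        fun x => x ^ p * (Real.exp (-b * x ^ 2) * f x) - c * (Real.exp (-b * x ^ 2) * f x) := by
      funext x; ring
    rw [e1, integral_sub hP (h0.const_mul c), integral_const_mul]
  rw [hR, hL] at hle
  have : (∫ x in Ioi (0:ℝ), x ^ p * (Real.exp (-b * x ^ 2) * f x)) ≤
      c * ∫ x in Ioi (0:ℝ), Real.exp (-b * x ^ 2) * f x := by linarith
  calc M0 * ∫ x in Ioi (0:ℝ), x ^ p * (Real.exp (-b * x ^ 2) * f x)
      ≤ M0 * (c * ∫ x in Ioi (0:ℝ), Real.exp (-b * x ^ 2) * f x) :=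
        mul_le_mul_of_nonneg_left this hM0pos.le
    _ = Mp * ∫ x in Ioi (0:ℝ), Real.exp (-b * x ^ 2) * f x := by
        rw [hc]; field_simp

/-! ### The auxiliary function `ψ_p` (BL (5.10)–(5.11), derivative-free) -/

/-- `c_p(b) = M_p(b)/M_0(b) = ⟨|x|^p⟩₁`, the `p`-th absolute moment of the Gaussian law.
[cite: BrascampLieb1976, Thm 5.1 (the right-hand side `⟨|x|^α⟩₁`)] -/
def blC (b : ℝ) (p : ℕ) : ℝ := gaussHalfMoment b p / gaussHalfMoment b 0

/-- `Φ_p(y) = -∫_0^y (t^p - c_p) e^{-bt²} dt` (`= ∫_y^∞ (t^p - c_p) e^{-bt²} dt` for `y ≥ 0`):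
`e^{-by²} ψ_p(y)` for the increasing weight `ψ_p` playing the role of the printed `ψ` of (5.11).
[cite: BrascampLieb1976, Lemma 5.3 eqs. (5.10)–(5.11)] -/
def blPhi (b : ℝ) (p : ℕ) (y : ℝ) : ℝ :=
  -∫ t in (0:ℝ)..y, (t ^ p - blC b p) * Real.exp (-b * t ^ 2)

/-- `ψ_p(y) = e^{b y²} Φ_p(y)` — the increasing weight of the printed (5.10)–(5.11) in one-variable
form. [cite: BrascampLieb1976, Lemma 5.3 eqs. (5.10)–(5.11)] -/
def blPsi (b : ℝ) (p : ℕ) (y : ℝ) : ℝ := blPhi b p y * Real.exp (b * y ^ 2)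

/-- `λ_p = ψ_p'`, in closed form `λ_p(y) = 2b y ψ_p(y) − (y^p − c_p)` (the printed `ψ'` of the last
display of the proof of Lemma 5.3). [cite: BrascampLieb1976, Lemma 5.3 eqs. (5.10)–(5.11)] -/
def blLam (b : ℝ) (p : ℕ) (y : ℝ) : ℝ := 2 * b * y * blPsi b p y - (y ^ p - blC b p)

/-- `c_p ≥ 0`. [cite: BrascampLieb1976, Thm 5.1 (`⟨|x|^α⟩₁ ≥ 0`)] -/
theorem blC_nonneg {b : ℝ} (hb : 0 < b) (p : ℕ) : 0 ≤ blC b p :=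
  (div_pos (gaussHalfMoment_pos hb p) (gaussHalfMoment_pos hb 0)).le

/-- `c_p M_0 = M_p`. [cite: BrascampLieb1976, Thm 5.1 (definition of `⟨·⟩₁`)] -/
theorem blC_mul_gaussHalfMoment_zero {b : ℝ} (hb : 0 < b) (p : ℕ) :
    blC b p * gaussHalfMoment b 0 = gaussHalfMoment b p := by
  rw [blC, div_mul_cancel₀ _ (gaussHalfMoment_pos hb 0).ne']

/-- Continuity of `(t^p − c_p) e^{-bt²}`. [folklore] -/
private theorem continuous_integrand (b : ℝ) (p : ℕ) :
    Continuous fun t : ℝ => (t ^ p - blC b p) * Real.exp (-b * t ^ 2) := by fun_prop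

/-- Integrability of `(t^p − c_p) e^{-bt²}`. [folklore] -/
private theorem integrable_sub_blC_mul_gauss {b : ℝ} (hb : 0 < b) (p : ℕ) :
    Integrable fun t : ℝ => (t ^ p - blC b p) * Real.exp (-b * t ^ 2) := by
  have : (fun t : ℝ => (t ^ p - blC b p) * Real.exp (-b * t ^ 2)) =
      fun t => t ^ p * Real.exp (-b * t ^ 2) - blC b p * Real.exp (-b * t ^ 2) := by
    funext t; ring
  rw [this]
  exact (integrable_pow_mul_gauss hb p).sub ((integrable_exp_neg_mul_sq hb).const_mul _)

/-- `∫_{(0,∞)} (t^p − c_p) e^{-bt²} dt = 0` (the choice of `c_p`). [folklore] -/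
private theorem setIntegral_Ioi_sub_blC_mul_gauss {b : ℝ} (hb : 0 < b) (p : ℕ) :
    ∫ t in Ioi (0:ℝ), (t ^ p - blC b p) * Real.exp (-b * t ^ 2) = 0 := by
  have e1 : (fun t : ℝ => (t ^ p - blC b p) * Real.exp (-b * t ^ 2)) =
      fun t => t ^ p * Real.exp (-b * t ^ 2) - blC b p * Real.exp (-b * t ^ 2) := by
    funext t; ring
  rw [e1, integral_sub (integrable_pow_mul_gauss hb p).integrableOn
    ((integrable_exp_neg_mul_sq hb).const_mul _).integrableOn, integral_const_mul]
  have h0 : ∫ t in Ioi (0:ℝ), Real.exp (-b * t ^ 2) = gaussHalfMoment b 0 := by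
    simp [gaussHalfMoment]
  rw [h0, blC_mul_gaussHalfMoment_zero hb, gaussHalfMoment, sub_self]

/-- For `y ≥ 0`: `Φ_p(y) = ∫_{(y,∞)} (t^p − c_p) e^{-bt²} dt`. [folklore] -/
private theorem blPhi_eq_setIntegral_Ioi {b : ℝ} (hb : 0 < b) (p : ℕ) {y : ℝ} (hy : 0 ≤ y) :
    blPhi b p y = ∫ t in Ioi y, (t ^ p - blC b p) * Real.exp (-b * t ^ 2) := by
  have h := intervalIntegral.integral_Ioi_sub_Ioi (μ := volume)
    (integrable_sub_blC_mul_gauss hb p).integrableOn hy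
  rw [setIntegral_Ioi_sub_blC_mul_gauss hb, zero_sub] at h
  rw [blPhi, ← h, neg_neg]

/-- `Φ_p' = −(y^p − c_p) e^{-by²}`. [folklore] -/
private theorem hasDerivAt_blPhi (b : ℝ) (p : ℕ) (y : ℝ) :
    HasDerivAt (blPhi b p) (-((y ^ p - blC b p) * Real.exp (-b * y ^ 2))) y := by
  have hc := continuous_integrand b p
  exact (intervalIntegral.integral_hasDerivAt_right (hc.intervalIntegrable _ _)
    (hc.stronglyMeasurableAtFilter _ _) hc.continuousAt).neg

/-- `ψ_p' = λ_p`. [cite: BrascampLieb1976, Lemma 5.3 eqs. (5.10)–(5.11)] -/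
theorem hasDerivAt_blPsi {b : ℝ} (p : ℕ) (y : ℝ) :
    HasDerivAt (blPsi b p) (blLam b p y) y := by
  have h1 : HasDerivAt (fun x => b * x ^ 2) (b * (2 * y)) y := by
    simpa using ((hasDerivAt_pow 2 y).const_mul b)
  have h2 := (hasDerivAt_blPhi b p y).mul h1.exp
  refine h2.congr_deriv ?_
  have : Real.exp (-b * y ^ 2) * Real.exp (b * y ^ 2) = 1 := by
    rw [← Real.exp_add]; simp
  simp only [blLam, blPsi]
  linear_combination (-(y ^ p - blC b p)) * this

/-- `ψ_p(0) = 0`. [cite: BrascampLieb1976, Lemma 5.3 eqs. (5.10)–(5.11)] -/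
theorem blPsi_zero (b : ℝ) (p : ℕ) : blPsi b p 0 = 0 := by
  simp [blPsi, blPhi]

/-- `ψ_p` is continuous. [cite: BrascampLieb1976, Lemma 5.3 eqs. (5.10)–(5.11)] -/
theorem continuous_blPsi (b : ℝ) (p : ℕ) : Continuous (blPsi b p) :=
  continuous_iff_continuousAt.2 fun y => (hasDerivAt_blPsi p y).continuousAt

/-- `λ_p` is continuous. [cite: BrascampLieb1976, Lemma 5.3 eqs. (5.10)–(5.11)] -/
theorem continuous_blLam (b : ℝ) (p : ℕ) : Continuous (blLam b p) := by
  unfold blLam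
  have := continuous_blPsi b p
  fun_prop

/-- `ψ_p(y) = ∫_0^y λ_p`. [cite: BrascampLieb1976, Lemma 5.3 eqs. (5.10)–(5.11)] -/
theorem blPsi_eq_integral_blLam (b : ℝ) (p : ℕ) (y : ℝ) :
    blPsi b p y = ∫ s in (0:ℝ)..y, blLam b p s := by
  rw [intervalIntegral.integral_eq_sub_of_hasDerivAt (fun s _ => hasDerivAt_blPsi p s)
    ((continuous_blLam b p).intervalIntegrable _ _), blPsi_zero, sub_zero]

/-- The key identity behind `λ_p ≥ 0`: for `y ≥ 0`,
`λ_p(y) e^{-by²} = 2b ∫_{(y,∞)} [y (t^p − c_p) − t (y^p − c_p)] e^{-bt²} dt`. [folklore] -/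
private theorem blLam_mul_gauss_eq {b : ℝ} (hb : 0 < b) (p : ℕ) {y : ℝ} (hy : 0 ≤ y) :
    blLam b p y * Real.exp (-b * y ^ 2) = 2 * b * ∫ t in Ioi y,
      (y * (t ^ p - blC b p) - t * (y ^ p - blC b p)) * Real.exp (-b * t ^ 2) := by
  have hI1 : IntegrableOn (fun t : ℝ => (t ^ p - blC b p) * Real.exp (-b * t ^ 2)) (Ioi y) :=
    (integrable_sub_blC_mul_gauss hb p).integrableOn
  have hI2 : IntegrableOn (fun t : ℝ => t * Real.exp (-b * t ^ 2)) (Ioi y) :=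
    (integrable_mul_exp_neg_mul_sq hb).integrableOn
  have e1 : (fun t : ℝ => (y * (t ^ p - blC b p) - t * (y ^ p - blC b p)) *
      Real.exp (-b * t ^ 2)) = fun t => y * ((t ^ p - blC b p) * Real.exp (-b * t ^ 2)) -
        (y ^ p - blC b p) * (t * Real.exp (-b * t ^ 2)) := by
    funext t; ring
  rw [e1, integral_sub (hI1.const_mul y) (hI2.const_mul _), integral_const_mul,
    integral_const_mul, ← blPhi_eq_setIntegral_Ioi hb p hy]
  have hw : Real.exp (-b * y ^ 2) = 2 * b * ∫ t in Ioi y, t * Real.exp (-b * t ^ 2) :=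
    (two_mul_setIntegral_Ioi_id_mul_gauss hb y).symm
  have hψ : blPsi b p y * Real.exp (-b * y ^ 2) = blPhi b p y := by
    rw [blPsi, mul_assoc, ← Real.exp_add]; simp
  calc blLam b p y * Real.exp (-b * y ^ 2)
      = 2 * b * y * (blPsi b p y * Real.exp (-b * y ^ 2))
          - (y ^ p - blC b p) * Real.exp (-b * y ^ 2) := by rw [blLam]; ring
    _ = 2 * b * y * blPhi b p y - (y ^ p - blC b p) *
          (2 * b * ∫ t in Ioi y, t * Real.exp (-b * t ^ 2)) := by rw [hψ, ← hw]
    _ = _ := by ring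

/-- `λ_p ≥ 0` on `[0, ∞)` when `p ≥ 1` (this is where `α ≥ 1` of the printed theorem enters).
[cite: BrascampLieb1976, Lemma 5.3, last line of the proof] -/
theorem blLam_nonneg {b : ℝ} (hb : 0 < b) {p : ℕ} (hp : p ≠ 0) {y : ℝ} (hy : 0 ≤ y) :
    0 ≤ blLam b p y := by
  have hw : 0 < Real.exp (-b * y ^ 2) := Real.exp_pos _
  suffices h : 0 ≤ blLam b p y * Real.exp (-b * y ^ 2) from nonneg_of_mul_nonneg_left h hw
  rw [blLam_mul_gauss_eq hb p hy]
  refine mul_nonneg (by positivity) (setIntegral_nonneg measurableSet_Ioi fun t ht => ?_)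
  have hyt : y ≤ t := le_of_lt ht
  have ht0 : 0 ≤ t := hy.trans hyt
  refine mul_nonneg ?_ (Real.exp_pos _).le
  obtain ⟨q, rfl⟩ := Nat.exists_eq_succ_of_ne_zero hp
  have h1 : y ^ q ≤ t ^ q := pow_le_pow_left₀ hy hyt q
  have hc := blC_nonneg hb (q + 1)
  have : y * (t ^ (q + 1) - blC b (q + 1)) - t * (y ^ (q + 1) - blC b (q + 1)) =
      y * t * (t ^ q - y ^ q) + blC b (q + 1) * (t - y) := by ring
  rw [this]
  have h2 : 0 ≤ y * t * (t ^ q - y ^ q) := mul_nonneg (mul_nonneg hy ht0) (by linarith)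
  have h3 : 0 ≤ blC b (q + 1) * (t - y) := mul_nonneg hc (by linarith)
  linarith

/-- `ψ_p ≥ 0` on `[0, ∞)` (the printed `ψ ≥ 0`). [cite: BrascampLieb1976, Lemma 5.3 eqs. (5.10)–(5.11)] -/
theorem blPsi_nonneg {b : ℝ} (hb : 0 < b) {p : ℕ} (hp : p ≠ 0) {y : ℝ} (hy : 0 ≤ y) :
    0 ≤ blPsi b p y := by
  rw [blPsi_eq_integral_blLam]
  exact intervalIntegral.integral_nonneg hy fun s hs => blLam_nonneg hb hp hs.1

/-- `(u + y)^p ≤ 2^p (u^p + y^p)` for `u, y ≥ 0`. [folklore] -/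
private theorem add_pow_le_two_pow_mul {u y : ℝ} (hu : 0 ≤ u) (hy : 0 ≤ y) (p : ℕ) :
    (u + y) ^ p ≤ 2 ^ p * (u ^ p + y ^ p) := by
  rcases le_total u y with h | h
  · calc (u + y) ^ p ≤ (2 * y) ^ p := pow_le_pow_left₀ (by positivity) (by linarith) p
      _ = 2 ^ p * y ^ p := mul_pow _ _ _
      _ ≤ 2 ^ p * (u ^ p + y ^ p) := by gcongr; linarith [pow_nonneg hu p]
  · calc (u + y) ^ p ≤ (2 * u) ^ p := pow_le_pow_left₀ (by positivity) (by linarith) p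
      _ = 2 ^ p * u ^ p := mul_pow _ _ _
      _ ≤ 2 ^ p * (u ^ p + y ^ p) := by gcongr; linarith [pow_nonneg hy p]

/-- Growth bound: `ψ_p(y) ≤ 2^p (M_p + M_0 y^p)` for `y ≥ 0` (polynomial growth of the printed weight
`ψ`; used for integrability in the Tonelli step). [cite: BrascampLieb1976, Lemma 5.3 eqs. (5.10)–(5.11)] -/
theorem blPsi_le {b : ℝ} (hb : 0 < b) (p : ℕ) {y : ℝ} (hy : 0 ≤ y) :
    blPsi b p y ≤ 2 ^ p * (gaussHalfMoment b p + gaussHalfMoment b 0 * y ^ p) := by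
  have hc := blC_nonneg hb p
  -- Step 1: `Φ_p(y) ≤ ∫_{(y,∞)} t^p e^{-bt²}`
  have hI1 : IntegrableOn (fun t : ℝ => (t ^ p - blC b p) * Real.exp (-b * t ^ 2)) (Ioi y) :=
    (integrable_sub_blC_mul_gauss hb p).integrableOn
  have hI2 : IntegrableOn (fun t : ℝ => t ^ p * Real.exp (-b * t ^ 2)) (Ioi y) :=
    (integrable_pow_mul_gauss hb p).integrableOn
  have h1 : blPhi b p y ≤ ∫ t in Ioi y, t ^ p * Real.exp (-b * t ^ 2) := by
    rw [blPhi_eq_setIntegral_Ioi hb p hy]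
    refine setIntegral_mono_on hI1 hI2 measurableSet_Ioi fun t _ => ?_
    have := Real.exp_pos (-b * t ^ 2)
    nlinarith
  -- Step 2: translate and compare with `e^{-by²} · 2^p (M_p + M_0 y^p)`
  have h2 : (∫ t in Ioi y, t ^ p * Real.exp (-b * t ^ 2)) ≤
      Real.exp (-b * y ^ 2) * (2 ^ p * (gaussHalfMoment b p + gaussHalfMoment b 0 * y ^ p)) := by
    rw [setIntegral_Ioi_eq_comp_add]
    have hJ : IntegrableOn (fun u : ℝ => Real.exp (-b * y ^ 2) * (2 ^ p *
        (u ^ p * Real.exp (-b * u ^ 2) + y ^ p * Real.exp (-b * u ^ 2)))) (Ioi 0) :=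
      ((((integrable_pow_mul_gauss hb p).add ((integrable_exp_neg_mul_sq hb).const_mul _)
        ).const_mul _).const_mul _).integrableOn
    have hK : IntegrableOn (fun u : ℝ => (u + y) ^ p * Real.exp (-b * (u + y) ^ 2)) (Ioi 0) :=
      ((integrable_pow_mul_gauss hb p).comp_add_right y).integrableOn
    calc (∫ u in Ioi (0:ℝ), (u + y) ^ p * Real.exp (-b * (u + y) ^ 2))
        ≤ ∫ u in Ioi (0:ℝ), Real.exp (-b * y ^ 2) * (2 ^ p *
            (u ^ p * Real.exp (-b * u ^ 2) + y ^ p * Real.exp (-b * u ^ 2))) := by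
          refine setIntegral_mono_on hK hJ measurableSet_Ioi fun u hu => ?_
          have hu0 : 0 ≤ u := le_of_lt hu
          have h2uy : 0 ≤ b * (2 * u * y) := by positivity
          have hsq : -b * (u + y) ^ 2 ≤ -b * y ^ 2 + -b * u ^ 2 := by
            linarith [show -b * (u + y) ^ 2 = -b * y ^ 2 + -b * u ^ 2 - b * (2 * u * y) by ring]
          have hexp : Real.exp (-b * (u + y) ^ 2) ≤ Real.exp (-b * y ^ 2) * Real.exp (-b * u ^ 2) := by
            rw [← Real.exp_add]; exact Real.exp_le_exp.2 hsq
          have hpw := add_pow_le_two_pow_mul hu0 hy p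
          calc (u + y) ^ p * Real.exp (-b * (u + y) ^ 2)
              ≤ (2 ^ p * (u ^ p + y ^ p)) * (Real.exp (-b * y ^ 2) * Real.exp (-b * u ^ 2)) :=
                mul_le_mul hpw hexp (Real.exp_pos _).le (by positivity)
            _ = _ := by ring
      _ = Real.exp (-b * y ^ 2) * (2 ^ p * (gaussHalfMoment b p + gaussHalfMoment b 0 * y ^ p)) := by
          rw [integral_const_mul, integral_const_mul, integral_add
            (integrable_pow_mul_gauss hb p).integrableOn
            ((integrable_exp_neg_mul_sq hb).const_mul _).integrableOn, integral_const_mul]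
          simp [gaussHalfMoment, mul_comm]
  -- Step 3: multiply by `e^{by²}`
  have hpos : 0 < Real.exp (b * y ^ 2) := Real.exp_pos _
  have hone : Real.exp (-b * y ^ 2) * Real.exp (b * y ^ 2) = 1 := by
    rw [← Real.exp_add]; simp
  calc blPsi b p y = blPhi b p y * Real.exp (b * y ^ 2) := rfl
    _ ≤ (Real.exp (-b * y ^ 2) * (2 ^ p * (gaussHalfMoment b p + gaussHalfMoment b 0 * y ^ p)))
          * Real.exp (b * y ^ 2) := mul_le_mul_of_nonneg_right (h1.trans h2) hpos.le
    _ = 2 ^ p * (gaussHalfMoment b p + gaussHalfMoment b 0 * y ^ p) := by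
          linear_combination (2 ^ p * (gaussHalfMoment b p + gaussHalfMoment b 0 * y ^ p)) * hone

end Literature.Probability.Distributions
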